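import Summits.RiemannHypothesis.RiemannHypothesis.Theorems.HandoffDecomposition
import HarnessLib

/-!
# HANDOFF — «H(q) for all q ≥ Q₀» IS RH, and so is «H(q) for infinitely many q» (cell rh-explicit, TRACK «HANDOFF», seat theory-2
# gen13; the barrier question T3 of RH-PROMISE «PROVABLE-NOW TARGETS», answered by name for the full handoff inequality)

HONEST FRAMING. Nothing here proves or approaches RH. `HandoffH q` (prove-2/theory-1's `HandoffDecomposition`) is Weil positivity
on the window up to `(log q⁺)/2`, and the windows are NESTED (`HandoffH.anti`: `H(q)` gives `H(q')` for every prime `q' ≤ q`).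
Hence any TAIL of the family, and even any INFINITE SUBFAMILY, is the whole family, which is RH
(`riemannHypothesis_iff_forall_handoffH`). So the answer to «is an "H(q) for all q ≥ Q₀" theorem RH-equivalent?» is YES, for
every `Q₀`, for the trivial reason of monotonicity — any proof of such a tail statement is a proof of RH and must do whatever a proof
of RH must do; there is no weaker «asymptotic» version of the handoff programme. (XII-s `HandoffSectorCriterion` has the same for
each parity sector separately; this file states it for `H` itself, importing only `HandoffDecomposition`.)
-/

set_option linter.dupNamespace false  -- the mandated namespace repeats `RiemannHypothesis`

namespace Summit.RiemannHypothesis.RiemannHypothesis.Theorems.HandoffEventually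

open Summit.RiemannHypothesis.RiemannHypothesis.Theorems.HandoffDecomposition Filter

/-- **A TAIL OF THE HANDOFF FAMILY IS RH.** `RH ↔ ∃ N, ∀ primes q ≥ N, H(q)`: «→» is `handoffH_of_riemannHypothesis`; «←»: every
prime `q` lies below some prime `p ≥ max N q` (Euclid), and `H(p)` gives `H(q)` by the nesting of the windows (`HandoffH.anti`).
[cite: Bombieri2000Weil, §4 (monotonicity of Weil positivity in the support); this track] -/
theorem riemannHypothesis_iff_eventually_handoffH :
    Summit.RiemannHypothesis ↔ ∃ N : ℕ, ∀ q : ℕ, N ≤ q → q.Prime → HandoffH q := by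
  refine ⟨fun hRH ↦ ⟨0, fun q _ hq ↦ handoffH_of_riemannHypothesis hRH hq⟩, fun ⟨N, h⟩ ↦ ?_⟩
  rw [riemannHypothesis_iff_forall_handoffH]
  intro q hq
  obtain ⟨p, hNp, hp⟩ := Nat.exists_infinite_primes (max N q)
  exact (h p ((le_max_left _ _).trans hNp) hp).anti hp hq ((le_max_right _ _).trans hNp)

/-- The same with the `atTop` filter: `RH ↔ ∀ᶠ q in atTop, (q prime → H(q))`. [folklore packaging] -/
theorem riemannHypothesis_iff_eventually_atTop_handoffH :
    Summit.RiemannHypothesis ↔ ∀ᶠ q : ℕ in atTop, q.Prime → HandoffH q := by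
  rw [riemannHypothesis_iff_eventually_handoffH, eventually_atTop]

/-- **INFINITELY MANY HANDOFFS ARE RH.** `RH ↔ ∀ N, ∃ prime q ≥ N with H(q)`: an infinite subfamily of the `H(q)` already gives
every `H(q)` by nesting. So neither «eventually» nor «infinitely often» weakens the target. [this track] -/
theorem riemannHypothesis_iff_frequently_handoffH :
    Summit.RiemannHypothesis ↔ ∀ N : ℕ, ∃ q : ℕ, N ≤ q ∧ q.Prime ∧ HandoffH q := by
  refine ⟨fun hRH N ↦ ?_, fun h ↦ ?_⟩
  · obtain ⟨p, hNp, hp⟩ := Nat.exists_infinite_primes N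
    exact ⟨p, hNp, hp, handoffH_of_riemannHypothesis hRH hp⟩
  · rw [riemannHypothesis_iff_forall_handoffH]
    intro q hq
    obtain ⟨p, hqp, hp, hH⟩ := h q
    exact hH.anti hp hq hqp

/-- **CONTRAPOSITIVE (the refuter's reading).** If RH fails, `H(q)` fails for ALL sufficiently large primes `q` — past the first
failure every later handoff fails too. [this track] -/
theorem eventually_not_handoffH_of_not_riemannHypothesis (h : ¬ Summit.RiemannHypothesis) :
    ∃ N : ℕ, ∀ q : ℕ, N ≤ q → q.Prime → ¬ HandoffH q := by
  by_contra hcon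
  push Not at hcon
  exact h (riemannHypothesis_iff_frequently_handoffH.2 fun N ↦ by
    obtain ⟨q, hNq, hq, hH⟩ := hcon N
    exact ⟨q, hNq, hq, hH⟩)

end Summit.RiemannHypothesis.RiemannHypothesis.Theorems.HandoffEventually
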